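import Literature.Barriers.PneNP.TSPExtensionComplexityRothvossGood
import Literature.Barriers.PneNP.TSPExtensionComplexityRothvossAssembly
import Summits.PneNP.PneNP.Theorems.ChebyshevTracialDesignJuntaMatchingCount
import HarnessLib

/-!
# Cell pnp-psdrank, route `ChebyshevTracialDesign`: perfect matchings closed on two prescribed vertex sets
# (the matching-side block count for the σ₂ brick), and the double-factorial law of `pmCount`

Harmonic backbone of the `r = 1` rung of the crux `TracialDecayExp20` (stmt-PneNP-19878), matching side.
Prover g5's route (R1) to the even eigenvalues `λ_{2κ}` of the tight Gram kernel (MEMO-7 ADDENDUM §B) reduces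
them to ONE count: for two vertex sets `T, T'` of `K_n`, the number of perfect matchings `M` for which BOTH `T`
and `T'` are unions of edges of `M` ("`M`-closed": `partner x ∈ T` for all `x ∈ T`). Such an `M` is exactly a
perfect matching respecting the four blocks `T ∩ T'`, `T ∖ T'`, `T' ∖ T`, `(T ∪ T')ᶜ`, so by the tree's block
product (`Literature.Barriers.PneNP.card_blockPM`) the count is
`pm(|T ∩ T'|) · pm(|T ∖ T'|) · pm(|T' ∖ T|) · pm(|(T ∪ T')ᶜ|)` with `pm = pmCount` the number of perfect matchings
of a labelled set (`card_filter_closed_closed`; single set: `card_filter_closed`). We also record the arithmetic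
of `pmCount` that the assembly of `λ_{2κ}` needs: `pmCount (2m) · 2^m · m! = (2m)!` (from the junta files'
partner recursion `card_pm_filter_cr_mul`), `pmCount (2m) = (2m−1)‼`, `pmCount` vanishes on odd sizes, and
`(s+1) · pmCount s = pmCount (s+2)`. No definitions. [folklore] counting; the perfect-matching association
scheme background is [cite: GodsilMeagher2015, §15.2].
WHAT THIS IS NOT: not the eigenvalue formula (★★) itself (prover's assembly), nothing on psd rank; instrument for
the σ₂ step of the `r = 1` rung. Supports crux stmt-PneNP-19878.
-/

set_option linter.dupNamespace false -- `Summit.PneNP.PneNP.…`: summit = sub-problem (D-0017)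

namespace Summit.PneNP.PneNP.Theorems.ChebyshevTracialDesignClosedPairCount

open Finset Literature.Barriers.PneNP Literature.Combinatorics.SimpleGraph.CycleSpace
open Summit.PneNP.PneNP.Theorems.ChebyshevTracialDesignJunta

/-! ### §1 The number of perfect matchings of a labelled set: `pmCount` -/

/-- The number of perfect matchings of a finite set `B` is `pmCount |B|`. [folklore] -/
theorem card_perfectMatchings_eq_pmCount {V : Type*} [DecidableEq V] (B : Finset V) :
    (perfectMatchings B).card = pmCount B.card := by
  rw [card_perfectMatchings_eq_fin B, pmCount]

/-- `pmCount (2m) · (2^m · m!) = (2m)!` (the junta files' partner recursion at the empty cut). [folklore] -/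
theorem pmCount_two_mul_mul (m : ℕ) : pmCount (2 * m) * (2 ^ m * m.factorial) = (2 * m).factorial := by
  classical
  have hS : ((univ : Finset (Fin (2 * m))) \ ∅).card = 0 + 2 * m := by simp
  have h := card_pm_filter_cr_mul (S := (univ : Finset (Fin (2 * m)))) (U := ∅) (empty_subset _)
    (a := 0) (i := 0) (i' := m) (by simp) hS
  have hfilter : ((perfectMatchings (univ : Finset (Fin (2 * m)))).filter
      fun M => (M.filter fun e => cutCount (∅ : Finset (Fin (2 * m))) e = 1).card = 0) =
        perfectMatchings univ := by
    refine filter_true_of_mem fun M _ => ?_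
    rw [card_eq_zero, filter_eq_empty_iff]
    intro e _
    induction e using Sym2.ind with
    | h x y => simp
  rw [hfilter] at h
  simpa [pmCount, Nat.factorial_zero] using h

/-- **`pmCount (2m) = (2m − 1)‼`.** [folklore] -/
theorem pmCount_two_mul (m : ℕ) : pmCount (2 * m) = (2 * m - 1).doubleFactorial := by
  have h := pmCount_two_mul_mul m
  rcases m with _ | m
  · simp [pmCount_zero]
  · have h2 : (2 * (m + 1)).factorial =
        (2 * m + 1).doubleFactorial * (2 ^ (m + 1) * (m + 1).factorial) := by
      rw [show 2 * (m + 1) = (2 * m + 1) + 1 by ring, Nat.factorial_eq_mul_doubleFactorial,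
        show 2 * m + 1 + 1 = 2 * (m + 1) by ring, Nat.doubleFactorial_two_mul, mul_comm]
    rw [h2] at h
    rw [show 2 * (m + 1) - 1 = 2 * m + 1 by omega]
    have hpos : 0 < 2 ^ (m + 1) * (m + 1).factorial := by positivity
    exact Nat.eq_of_mul_eq_mul_right hpos h

/-- `pmCount` vanishes on odd sizes. [folklore] -/
theorem pmCount_two_mul_add_one (m : ℕ) : pmCount (2 * m + 1) = 0 := by
  classical
  rw [pmCount, card_eq_zero, ← not_nonempty_iff_eq_empty]
  rintro ⟨M, hM⟩
  have h := (mem_perfectMatchings.1 hM).two_mul_card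
  rw [card_univ, Fintype.card_fin] at h
  omega

/-- `pmCount s = 0` for odd `s`. [folklore] -/
theorem pmCount_of_odd {s : ℕ} (hs : Odd s) : pmCount s = 0 := by
  obtain ⟨m, rfl⟩ := hs
  exact pmCount_two_mul_add_one m

/-- `pmCount s = (s − 1)‼` for even `s`. [folklore] -/
theorem pmCount_of_even {s : ℕ} (hs : Even s) : pmCount s = (s - 1).doubleFactorial := by
  obtain ⟨m, rfl⟩ := hs
  rw [← two_mul, pmCount_two_mul]

/-- **The partner recursion for `pmCount`**: `(s + 1) · pmCount s = pmCount (s + 2)` (stated in this orientation;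
the tree's `Literature.Barriers.PneNP.pmCount` counts the perfect matchings of `Fin s`). [folklore] -/
theorem succ_mul_pmCount (s : ℕ) : (s + 1) * pmCount s = pmCount (s + 2) := by
  rcases Nat.even_or_odd s with ⟨m, rfl⟩ | ⟨m, rfl⟩
  · rw [← two_mul, show 2 * m + 2 = 2 * (m + 1) by ring, pmCount_two_mul, pmCount_two_mul,
      show 2 * (m + 1) - 1 = 2 * m + 1 by omega, Nat.doubleFactorial_add_one]
  · rw [show 2 * m + 1 + 2 = 2 * (m + 1) + 1 by ring, pmCount_two_mul_add_one, pmCount_two_mul_add_one,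
      mul_zero]

/-- `pmCount 2 = 1`. [folklore] -/
theorem pmCount_two : pmCount 2 = 1 := by
  rw [show (2 : ℕ) = 0 + 2 from rfl, ← succ_mul_pmCount, pmCount_zero]

/-! ### §2 `M`-closed vertex sets -/

variable {n : ℕ}

/-- A vertex set `T` is `M`-closed (`partner x ∈ T` for all `x ∈ T`) iff no edge of `M` crosses `T`. [folklore] -/
theorem closed_iff_forall_not_crosses (M : PMatch n) (T : Finset (Fin n)) :
    (∀ x ∈ T, M.2.partner x ∈ T) ↔ ∀ e ∈ M.1, ¬ Crosses T e := by
  constructor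
  · intro h e he hcr
    obtain ⟨a, b, rfl, ha, hb⟩ := crosses_iff_exists.1 hcr
    exact hb (M.2.eq_partner_of_mem he ▸ h a ha)
  · intro h x hx
    have he := M.2.mk_partner_mem x
    have hncr := h _ he
    rw [crosses_mk] at hncr
    by_contra hpx
    exact hncr (Or.inl ⟨hx, hpx⟩)

/-- For an `M`-closed `T` membership in `T` is invariant under the partner map. [folklore] -/
theorem mem_iff_partner_mem_of_closed {M : PMatch n} {T : Finset (Fin n)} (h : ∀ x ∈ T, M.2.partner x ∈ T)
    (x : Fin n) : x ∈ T ↔ M.2.partner x ∈ T := by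
  refine ⟨h x, fun hx => ?_⟩
  have := h _ hx
  rwa [M.2.partner_partner] at this

/-- `T` is `M`-closed iff all of its points are matched inside `T`:
`#{x ∈ T : partner x ∈ T} = |T|`. [folklore] -/
theorem closed_iff_card_filter_eq (M : PMatch n) (T : Finset (Fin n)) :
    (∀ x ∈ T, M.2.partner x ∈ T) ↔ (T.filter fun x => M.2.partner x ∈ T).card = T.card := by
  constructor
  · intro h
    rw [filter_eq_self.2 h]
  · intro h
    exact filter_eq_self.1 (eq_of_subset_of_card_le (filter_subset _ T) h.ge)

/-! ### §3 Perfect matchings closed on two sets are the block-respecting matchings of four blocks -/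

/-- Counting over the subtype `PMatch n` is counting over `perfectMatchings univ`. [folklore] -/
theorem card_filter_pmatch (Q : Finset (Sym2 (Fin n)) → Prop) [DecidablePred Q] :
    (univ.filter fun M : PMatch n => Q M.1).card =
      ((perfectMatchings (univ : Finset (Fin n))).filter Q).card := by
  refine card_bij (fun M _ => M.1) (fun M hM => ?_) (fun M _ M' _ h => Subtype.ext h) (fun M hM => ?_)
  · rw [mem_filter] at hM ⊢
    exact ⟨mem_perfectMatchings.2 M.2, hM.2⟩
  · rw [mem_filter] at hM
    exact ⟨⟨M, mem_perfectMatchings.1 hM.1⟩, mem_filter.2 ⟨mem_univ _, hM.2⟩, rfl⟩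

/-- **Perfect matchings no edge of which crosses `T` or `T'`** are counted by the block product over the four
blocks `T ∩ T'`, `T ∖ T'`, `T' ∖ T`, `(T ∪ T')ᶜ` (the tree's `card_blockPM`). [folklore] -/
theorem card_pm_filter_not_crosses_two (T T' : Finset (Fin n)) :
    ((perfectMatchings (univ : Finset (Fin n))).filter fun M =>
        (∀ e ∈ M, ¬ Crosses T e) ∧ ∀ e ∈ M, ¬ Crosses T' e).card =
      pmCount (T ∩ T').card * pmCount (T \ T').card * pmCount (T' \ T).card * pmCount (T ∪ T')ᶜ.card := by
  classical
  -- the membership pattern of a vertex and the four pattern blocks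
  obtain ⟨f, hf⟩ : ∃ f : Fin n → Bool × Bool, ∀ x, f x = (decide (x ∈ T), decide (x ∈ T')) :=
    ⟨_, fun _ => rfl⟩
  obtain ⟨P, hP⟩ : ∃ P : Bool × Bool → Finset (Fin n), ∀ i, P i = univ.filter fun x => f x = i :=
    ⟨_, fun _ => rfl⟩
  have hmemP : ∀ i x, x ∈ P i ↔ f x = i := fun i x => by simp [hP]
  have hPd : ∀ i j, i ≠ j → Disjoint (P i) (P j) := by
    intro i j hij
    rw [disjoint_left]
    intro x hx hx'
    rw [hmemP] at hx hx'
    exact hij (hx.symm.trans hx')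
  have hPU : univ.biUnion P = univ := by
    ext x
    simp only [mem_biUnion, mem_univ, true_and, iff_true]
    exact ⟨f x, (hmemP _ _).2 rfl⟩
  -- an edge lies inside a block iff it crosses neither `T` nor `T'`
  have hedge : ∀ e : Sym2 (Fin n), (∃ i, e ∈ (P i).sym2) ↔ ¬ Crosses T e ∧ ¬ Crosses T' e := by
    intro e
    induction e using Sym2.ind with
    | h x y =>
      simp only [mk_mem_sym2_iff, hmemP, crosses_mk, hf]
      by_cases hxT : x ∈ T <;> by_cases hxT' : x ∈ T' <;> by_cases hyT : y ∈ T <;>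
        by_cases hyT' : y ∈ T' <;> simp [hxT, hxT', hyT, hyT']
  have hfilt : ((perfectMatchings (univ : Finset (Fin n))).filter fun M =>
        (∀ e ∈ M, ¬ Crosses T e) ∧ ∀ e ∈ M, ¬ Crosses T' e) =
      (perfectMatchings (univ.biUnion P)).filter fun M => ∀ e ∈ M, ∃ i, e ∈ (P i).sym2 := by
    rw [hPU]
    refine filter_congr fun M _ => ?_
    simp only [hedge]
    exact ⟨fun h e he => ⟨h.1 e he, h.2 e he⟩, fun h => ⟨fun e he => (h e he).1, fun e he => (h e he).2⟩⟩
  have hb : ((perfectMatchings (univ.biUnion P)).filter fun M => ∀ e ∈ M, ∃ i, e ∈ (P i).sym2).card =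
      ∏ i, (perfectMatchings (P i)).card := by
    convert card_blockPM P hPd
  rw [hfilt, hb, Fintype.prod_prod_type, Fintype.prod_bool, Fintype.prod_bool, Fintype.prod_bool]
  simp only [card_perfectMatchings_eq_pmCount]
  have htt : P (true, true) = T ∩ T' := by
    ext x; rw [hmemP, hf, mem_inter]; simp
  have htf : P (true, false) = T \ T' := by
    ext x; rw [hmemP, hf, mem_sdiff]; simp
  have hft : P (false, true) = T' \ T := by
    ext x; rw [hmemP, hf, mem_sdiff]; simp [and_comm]
  have hff : P (false, false) = (T ∪ T')ᶜ := by
    ext x; rw [hmemP, hf, mem_compl, mem_union, not_or]; simp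
  rw [htt, htf, hft, hff]
  ring

/-- **Block count for `M`-closed pairs.** The perfect matchings `M` of `K_n` for which both `T` and `T'` are
`M`-closed number `pm(|T ∩ T'|) · pm(|T ∖ T'|) · pm(|T' ∖ T|) · pm(|(T ∪ T')ᶜ|)`. [folklore] -/
theorem card_filter_closed_closed (T T' : Finset (Fin n)) :
    (univ.filter fun M : PMatch n =>
        (∀ x ∈ T, M.2.partner x ∈ T) ∧ ∀ x ∈ T', M.2.partner x ∈ T').card =
      pmCount (T ∩ T').card * pmCount (T \ T').card * pmCount (T' \ T).card * pmCount (T ∪ T')ᶜ.card := by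
  classical
  rw [← card_pm_filter_not_crosses_two T T',
    ← card_filter_pmatch (fun M => (∀ e ∈ M, ¬ Crosses T e) ∧ ∀ e ∈ M, ¬ Crosses T' e)]
  congr 1
  refine filter_congr fun M _ => ?_
  rw [closed_iff_forall_not_crosses, closed_iff_forall_not_crosses]

/-- **Single set.** The perfect matchings of `K_n` for which `T` is `M`-closed number `pm(|T|) · pm(|Tᶜ|)`.
[folklore] -/
theorem card_filter_closed (T : Finset (Fin n)) :
    (univ.filter fun M : PMatch n => ∀ x ∈ T, M.2.partner x ∈ T).card = pmCount T.card * pmCount Tᶜ.card := by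
  classical
  have h := card_filter_closed_closed T T
  rw [inter_self, sdiff_self, union_self, bot_eq_empty, card_empty, pmCount_zero, mul_one, mul_one] at h
  rw [← h]
  congr 1
  exact filter_congr fun M _ => (and_self_iff).symm

end Summit.PneNP.PneNP.Theorems.ChebyshevTracialDesignClosedPairCount
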